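import Summits.NavierStokesRegularity.NavierStokesRegularity.Theorems.SoloRefuteBazarbekov2020

/-!
# C42 `Bazarbekov2020` — kernel refutation of Step 1b (`Step1b_Ineq34pp`, Lemma 3.2 (3,4'') p.10:
# unweighted `L²` domination does not give weighted domination with a uniform constant) — records ADDENDUM

Cell `ns-claims` (D-0090 NS-CLAIMS SWEEP), claim C42, ADJUDICATED #56 at `Step2_Theorem31` (Theorem 3.1,
kill of record `Summit.NavierStokesRegularity.NavierStokesRegularity.Theorems.Bazarbekov2020.not_Step2_Theorem31`,
`Theorems/SoloRefuteBazarbekov2020.lean`). This file is the SECOND located failure, records-grade (head /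
class / totals of #56 untouched): the typed skeleton `Literature.Claims.NS.Bazarbekov2020` (p479582, typist-4 g2)
carries Lemma 3.2's printed inference (3,4'') as `Step1b_Ineq34pp` (TeX l.679–691 / p.10: «We shall prove by the
second inequality of (3,4') [`∫₀ᵗ p²(τ)dτ < c·∫₀ᵗ w²(τ)dτ`] that there exists a constant `c > 0`:
`∫₀ᵗ p²(τ)(t − τ)^{−μ}dτ < c·∫₀ᵗ w²(τ)(t − τ)^{−μ}dτ` (3,4'')», for all non-negative `p, w ∈ L₂(0,T)`,
the constant independent of `(p, w)`, `μ ∈ [5/8, 3/4)`). The proof below is the typist-4 g2 kit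
`claims/Bazarbekov2020/SoloRefuteBazarbekov2020.lean` (sha16 8c53fdb14b62276c, §Step 1b, published 2026-08-27
01:07Z, never filed — the row was keyed at Step 2), extracted verbatim into its own module by typist-4 g7
under a distinct namespace (dedup hygiene); the three Abel-kernel lemmas (`kernel_intervalIntegrable`,
`kernel_integrableOn`, `kernel_integral`) are REUSED from the landed `Theorems/SoloRefuteBazarbekov2020.lean`
(imported), not restated.

WHAT IS PROVED: `not_Step1b_Ineq34pp : ¬ Literature.Claims.NS.Bazarbekov2020.Step1b_Ineq34pp` — with
`μ = 5/8`, `T = 1`, `c = 2`, given any `c' > 0` put `M = (8/3)c' + 2`, `h = M⁻⁸`, `w ≡ 1`,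
`p = M⁴·𝟙_{(1−h,1)}`; the unweighted hypothesis holds for every `t ∈ (0,1]` (`∫₀ᵗp² ≤ 1 < 2t` once the
window is met, `0` before), while at `t = 1` the weighted left side is `≥ M⁸·h·h^{−5/8} = M⁵ ≥ M > (8/3)c'
= c'∫₀¹(1−τ)^{−5/8}` — so no uniform constant exists: cumulative `L²` domination from `0` does not control
the mass of `p²` next to the singular endpoint of the Abel kernel. Class (records): false lemma (countermodel)
at an inference the adjudicated head does not use (co-locator, CARD §7).

Closed terms; axioms `propext`, `Classical.choice`, `Quot.sound`.

WHAT THIS IS NOT: not a claim about NS regularity or blow-up; not a claim about any author beyond the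
typed locator.
-/

-- The summit's canonical theorem namespace repeats the summit name (single-conjunct summit).
set_option linter.dupNamespace false

noncomputable section

open Set MeasureTheory intervalIntegral

namespace Summit.NavierStokesRegularity.NavierStokesRegularity.Theorems.Bazarbekov2020Step1b

open Literature.Claims.NS.Bazarbekov2020
open Summit.NavierStokesRegularity.NavierStokesRegularity.Theorems.Bazarbekov2020
  (kernel_integral kernel_intervalIntegrable kernel_integrableOn)

/-! ## Step 1b — (3,4'') «unweighted ⇒ weighted with a uniform constant» is false (abstract grain, p.10) -/

section Step1b

variable (M : ℝ)

/-- The window width `h = M⁻⁸`. -/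
def hw : ℝ := (M ^ 8)⁻¹

/-- The window `S = (1 − h, 1)`. -/
def Sw : Set ℝ := Ioo (1 - hw M) 1

/-- The pressure-size witness `p = M⁴·𝟙_S`. -/
def pw (τ : ℝ) : ℝ := (Sw M).indicator (fun _ => M ^ 4) τ

/-- The `w`-size witness `w ≡ 1`. -/
def ww (_τ : ℝ) : ℝ := 1

variable {M}

/-- `S` is measurable. -/
lemma measurableSet_Sw (M : ℝ) : MeasurableSet (Sw M) := by unfold Sw; exact measurableSet_Ioo

/-- `h > 0`. -/
lemma hw_pos (hM : 2 ≤ M) : 0 < hw M := by unfold hw; positivity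

/-- `h·M⁸ = 1`. -/
lemma hw_mul (hM : 2 ≤ M) : hw M * M ^ 8 = 1 := by
  unfold hw; field_simp

/-- `h ≤ 1/256`. -/
lemma hw_le (hM : 2 ≤ M) : hw M ≤ 1 / 256 := by
  unfold hw
  have h8 : (256 : ℝ) ≤ M ^ 8 := by nlinarith [pow_le_pow_left₀ (by norm_num : (0:ℝ) ≤ 2) hM 8]
  rw [inv_eq_one_div]
  exact one_div_le_one_div_of_le (by norm_num) h8

/-- `h^{−5/8} = M⁵`. -/
lemma hw_rpow (hM : 2 ≤ M) : hw M ^ (-(5 / 8) : ℝ) = M ^ 5 := by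
  have hM0 : 0 ≤ M := by linarith
  unfold hw
  rw [← Real.rpow_natCast M 8, ← Real.rpow_neg hM0, ← Real.rpow_mul hM0]
  norm_num

/-- `p² = M⁸·𝟙_S`. -/
lemma pw_sq (τ : ℝ) : pw M τ ^ 2 = (Sw M).indicator (fun _ => M ^ 8) τ := by
  unfold pw
  by_cases hτ : τ ∈ Sw M
  · simp [hτ]; ring
  · simp [hτ]

/-- `p ≥ 0`. -/
lemma pw_nonneg (hM : 2 ≤ M) (τ : ℝ) : 0 ≤ pw M τ := by
  unfold pw
  by_cases hτ : τ ∈ Sw M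
  · simp [hτ]; positivity
  · simp [hτ]

/-- `p²` integrable on `(0,1)`. -/
lemma pw_sq_integrableOn (M : ℝ) : IntegrableOn (fun τ => pw M τ ^ 2) (Ioo (0 : ℝ) 1) := by
  have h : (fun τ => pw M τ ^ 2) = (Sw M).indicator (fun _ => M ^ 8) := funext (pw_sq (M := M))
  rw [h]
  exact (((continuous_const : Continuous fun _ : ℝ => M ^ 8).integrableOn_Icc (a := 0) (b := 1)).mono_set
    Ioo_subset_Icc_self).indicator measurableSet_Ioo

/-- `w²` integrable on `(0,1)`. -/
lemma ww_sq_integrableOn : IntegrableOn (fun τ => ww τ ^ 2) (Ioo (0 : ℝ) 1) :=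
  ((continuous_const : Continuous fun _ : ℝ => (1 : ℝ) ^ 2).integrableOn_Icc (a := 0) (b := 1)).mono_set
    Ioo_subset_Icc_self

/-- `∫₀ᵗ w² = t` for `t ∈ (0,1]`. -/
lemma integral_ww_sq {t : ℝ} (ht : t ∈ Ioc (0 : ℝ) 1) : ∫ τ in Ioo 0 t, ww τ ^ 2 = t := by
  unfold ww
  rw [setIntegral_const, Real.volume_real_Ioo_of_le ht.1.le]
  simp

/-- The unweighted hypothesis of (3,4''): `∫₀ᵗ p² < 2∫₀ᵗ w²` for every `t ∈ (0,1]`. -/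
lemma pw_hyp (hM : 2 ≤ M) {t : ℝ} (ht : t ∈ Ioc (0 : ℝ) 1) :
    ∫ τ in Ioo 0 t, pw M τ ^ 2 < 2 * ∫ τ in Ioo 0 t, ww τ ^ 2 := by
  rw [integral_ww_sq ht, setIntegral_congr_fun measurableSet_Ioo (fun τ _ => pw_sq (M := M) τ),
    setIntegral_indicator (measurableSet_Sw M), setIntegral_const, smul_eq_mul]
  unfold Sw
  rw [Ioo_inter_Ioo, Real.volume_real_Ioo]
  have hle := hw_le hM
  have hpos := hw_pos hM
  have hmul := hw_mul hM
  have h8 : 0 < M ^ 8 := by positivity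
  by_cases hcase : t ≤ 1 - hw M
  · have : max (min t 1 - max 0 (1 - hw M)) 0 = 0 := by
      apply max_eq_right
      have h1 : min t 1 ≤ t := min_le_left _ _
      have h2 : 1 - hw M ≤ max 0 (1 - hw M) := le_max_right _ _
      linarith
    rw [this, zero_mul]
    linarith [ht.1]
  · rw [not_le] at hcase
    have hmax : max (min t 1 - max 0 (1 - hw M)) 0 ≤ hw M := by
      apply max_le _ hpos.le
      have h1 : min t 1 ≤ 1 := min_le_right _ _
      have h2 : 1 - hw M ≤ max 0 (1 - hw M) := le_max_right _ _
      linarith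
    calc max (min t 1 - max 0 (1 - hw M)) 0 * M ^ 8 ≤ hw M * M ^ 8 :=
          mul_le_mul_of_nonneg_right hmax h8.le
      _ = 1 := hmul
      _ < 2 * t := by linarith

/-- The weighted right side at `t = 1`: `∫₀¹ w²(1 − τ)^{−5/8} = 8/3`. -/
lemma integral_ww_weighted : ∫ τ in Ioo (0 : ℝ) 1, ww τ ^ 2 * (1 - τ) ^ (-(5 / 8) : ℝ) = 8 / 3 := by
  unfold ww
  simp only [one_pow, one_mul]
  rw [kernel_integral one_pos, Real.one_rpow]
  norm_num

/-- The weighted left side at `t = 1` is at least `M⁵`. -/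
lemma pw_weighted_lb (hM : 2 ≤ M) :
    M ^ 5 ≤ ∫ τ in Ioo (0 : ℝ) 1, pw M τ ^ 2 * (1 - τ) ^ (-(5 / 8) : ℝ) := by
  have hpos := hw_pos hM
  have hle := hw_le hM
  have hmul := hw_mul hM
  have hS : Sw M ⊆ Ioo (0 : ℝ) 1 := by
    intro τ hτ; unfold Sw at hτ; exact ⟨by linarith [hτ.1], hτ.2⟩
  have hind : (fun τ => pw M τ ^ 2 * (1 - τ) ^ (-(5 / 8) : ℝ)) =
      (Sw M).indicator (fun τ => M ^ 8 * (1 - τ) ^ (-(5 / 8) : ℝ)) := by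
    funext τ
    rw [pw_sq]
    by_cases hτ : τ ∈ Sw M
    · simp [hτ]
    · simp [hτ]
  rw [hind, setIntegral_indicator (measurableSet_Sw M), inter_eq_right.mpr hS]
  have hk : IntegrableOn (fun τ => M ^ 8 * (1 - τ) ^ (-(5 / 8) : ℝ)) (Sw M) :=
    ((kernel_integrableOn one_pos).mono_set hS).const_mul _
  have hc : IntegrableOn (fun _ : ℝ => M ^ 8 * M ^ 5) (Sw M) :=
    ((continuous_const : Continuous fun _ : ℝ => M ^ 8 * M ^ 5).integrableOn_Icc
      (a := 0) (b := 1)).mono_set (hS.trans Ioo_subset_Icc_self)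
  have hmono : ∫ τ in Sw M, M ^ 8 * M ^ 5 ≤ ∫ τ in Sw M, M ^ 8 * (1 - τ) ^ (-(5 / 8) : ℝ) := by
    refine setIntegral_mono_on hc hk (measurableSet_Sw M) fun τ hτ => ?_
    unfold Sw at hτ
    have h1 : 0 < 1 - τ := by linarith [hτ.2]
    have h2 : 1 - τ ≤ hw M := by linarith [hτ.1]
    have hk5 : M ^ 5 ≤ (1 - τ) ^ (-(5 / 8) : ℝ) := by
      rw [← hw_rpow hM]
      exact Real.rpow_le_rpow_of_nonpos h1 h2 (by norm_num)
    exact mul_le_mul_of_nonneg_left hk5 (by positivity)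
  have hval : ∫ τ in Sw M, M ^ 8 * M ^ 5 = M ^ 5 := by
    rw [setIntegral_const, smul_eq_mul]
    unfold Sw
    rw [Real.volume_real_Ioo_of_le (by linarith)]
    calc (1 - (1 - hw M)) * (M ^ 8 * M ^ 5) = (hw M * M ^ 8) * M ^ 5 := by ring
      _ = M ^ 5 := by rw [hmul, one_mul]
  linarith

/-- **(3,4'') as printed is false** (`Step1b_Ineq34pp` of the skeleton, Lemma 3.2 p.10, l.679–691):
with `μ = 5/8`, `T = 1`, `c = 2` no constant `c'` works — given `c' > 0` put `M = (8/3)c' + 2`,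
`h = M⁻⁸`, `w ≡ 1`, `p = M⁴·𝟙_{(1−h,1)}`: then `∫₀ᵗ p² ≤ 1 < 2t = 2∫₀ᵗ w²` whenever the window is met
(`t > 1 − h ≥ 255/256`) and `= 0` before, while at `t = 1` the weighted left side is
`≥ M⁸·h·h^{−5/8} = M⁵ ≥ M > (8/3)c' = c'·∫₀¹(1 − τ)^{−5/8}dτ`.
[cite: Bazarbekov2020, Lemma 3.2 (3,4'') l.679–691 p.10] -/
theorem not_Step1b_Ineq34pp : ¬ Step1b_Ineq34pp := by
  intro h
  obtain ⟨c', hc', hall⟩ := h (5 / 8) 1 2 le_rfl (by norm_num) one_pos two_pos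
  set M : ℝ := 8 / 3 * c' + 2 with hMdef
  have hM : 2 ≤ M := by rw [hMdef]; linarith
  have hlt := hall (pw M) (ww) (pw_nonneg hM) (fun _ => zero_le_one) (pw_sq_integrableOn M)
    ww_sq_integrableOn (fun t ht => pw_hyp hM ht) 1 ⟨one_pos, le_rfl⟩
  rw [integral_ww_weighted] at hlt
  have hlb := pw_weighted_lb hM
  have hM5 : M ≤ M ^ 5 := le_self_pow₀ (by linarith) (by norm_num)
  have : c' * (8 / 3) < M := by rw [hMdef]; linarith
  linarith

end Step1b

end Summit.NavierStokesRegularity.NavierStokesRegularity.Theorems.Bazarbekov2020Step1b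

end
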